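import Literature.Topology.FourManifolds.BranchedDoubleQuotient
import Literature.Topology.FourManifolds.ParametricLocalDiffeo
import Mathlib.Analysis.Complex.OpenMapping
import Mathlib.Analysis.InnerProductSpace.Calculus
import Mathlib.LinearAlgebra.FiniteDimensional.Lemmas
import HarnessLib

/-!
# Local analysis of the branched double model `(z, w) ↦ (Re z, Re w, (Im z)² − (Im w)², 2 Im z Im w)`

Topic `Topology/FourManifolds`; namespace `Literature.Topology.FourManifolds`. Continuation of the
definition file `BranchedDoubleQuotient.lean` (`branchedDoubleModel`, the standard local model of
the quotient map `X → X/conj` at a real point: identity on real parts, the squaring map `ω ↦ ω²`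
of `ℂ ≅ ℝ²` on imaginary parts). Two analytic properties announced but not proved there
("these two analytic clauses (properness, inverse function theorem) are not formalised in this
definition file") and needed for the construction of the smooth structure on `X/conj`
(`ConjQuotientSmoothing.lean`):

* `isOpenMap_branchedDoubleModel` — the model is an OPEN map `ℂ² → ℝ⁴` (it is the product of a
  homeomorphism on the real parts with the squaring map of `ℂ`, which is open by the open mapping
  theorem, `isOpenQuotientMap_pow`), so the descended charts of the orbit space are open
  embeddings;
* `hasFDerivAt_branchedDoubleModel`, `branchedDoubleModelDeriv_injective`,
  `isLocalDiffeomorphAt_branchedDoubleModel` — its derivative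
  `h ↦ (Re h₀, Re h₁, 2(x Im h₀ − y Im h₁), 2(y Im h₀ + x Im h₁))`, `x = Im z`, `y = Im w`, is
  invertible off the real locus `{Im z = Im w = 0}` (determinant `4(x² + y²)`), so the model is a
  `C^∞` local diffeomorphism at every non-real point (inverse function theorem) — the branch
  locus of `X → X/conj` is exactly the real part.

Kuiper (1974), Massey (1973) (`ℂℙ²/conj`), Finashin (1996) §1 ¶2; all statements folklore.

## References

* [Finashin1996] S. Finashin, J. reine angew. Math. 481 (1996) = arXiv:dg-ga/9506007, §1 ¶2.
* [Kuiper1974] N. H. Kuiper, Math. Ann. 208 (1974), 175–177.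
-/

noncomputable section

open scoped Manifold ContDiff ComplexConjugate Topology
open Set Function

namespace Literature.Topology.FourManifolds

/-! ### The model as (homeomorphism) ∘ (id × squaring) ∘ (homeomorphism) -/

/-- A complex-valued map with continuous real and imaginary parts is continuous. [folklore] -/
theorem continuous_complex_mk {X : Type*} [TopologicalSpace X] {f g : X → ℝ} (hf : Continuous f)
    (hg : Continuous g) : Continuous fun x ↦ (⟨f x, g x⟩ : ℂ) :=
  Complex.equivRealProdCLM.symm.continuous.comp (hf.prodMk hg)

/-- `ℂ² ≃ₜ (ℝ × ℝ) × ℂ`, `(z, w) ↦ ((Re z, Re w), Im z + i Im w)`: real parts and the "normal"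
complex coordinate `c = Im z + i Im w` on which the model is the squaring map. [folklore] -/
def reImHomeomorph : (Fin 2 → ℂ) ≃ₜ (ℝ × ℝ) × ℂ where
  toFun v := (((v 0).re, (v 1).re), ⟨(v 0).im, (v 1).im⟩)
  invFun p := ![⟨p.1.1, p.2.re⟩, ⟨p.1.2, p.2.im⟩]
  left_inv v := by
    funext i
    fin_cases i <;> apply Complex.ext <;> simp
  right_inv p := by
    obtain ⟨⟨a, b⟩, ζ⟩ := p
    simp
  continuous_toFun := by
    refine Continuous.prodMk (by fun_prop) (continuous_complex_mk ?_ ?_) <;> fun_prop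
  continuous_invFun := by
    refine continuous_pi fun i ↦ ?_
    fin_cases i
    · simpa using continuous_complex_mk (by fun_prop) (by fun_prop)
    · simpa using continuous_complex_mk (by fun_prop) (by fun_prop)

/-- `(ℝ × ℝ) × ℂ ≃ₜ ℝ⁴`, `((a, b), ζ) ↦ (a, b, Re ζ, Im ζ)`. [folklore] -/
def quadHomeomorph : (ℝ × ℝ) × ℂ ≃ₜ EuclideanSpace ℝ (Fin 4) where
  toFun p := WithLp.toLp 2 ![p.1.1, p.1.2, p.2.re, p.2.im]
  invFun w := ((w 0, w 1), ⟨w 2, w 3⟩)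
  left_inv p := by
    obtain ⟨⟨a, b⟩, ζ⟩ := p
    simp
  right_inv w := by
    ext i
    fin_cases i <;> simp
  continuous_toFun := by
    refine (PiLp.continuous_toLp 2 _).comp (continuous_pi fun i ↦ ?_)
    fin_cases i <;> simp <;> fun_prop
  continuous_invFun := by
    have hc : ∀ i : Fin 4, Continuous fun w : EuclideanSpace ℝ (Fin 4) ↦ w i := fun i ↦
      (continuous_apply i).comp (PiLp.continuous_ofLp 2 _)
    exact ((hc 0).prodMk (hc 1)).prodMk (continuous_complex_mk (hc 2) (hc 3))

/-- **Factorisation of the model**: `branchedDoubleModel = quadHomeomorph ∘ (id × (c ↦ c²)) ∘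
reImHomeomorph` — identity on the real parts, squaring on `c = Im z + i Im w`. [folklore] -/
theorem branchedDoubleModel_eq_comp :
    branchedDoubleModel = quadHomeomorph ∘ Prod.map id (fun c : ℂ ↦ c ^ 2) ∘ reImHomeomorph := by
  funext v
  ext i
  fin_cases i <;> simp [branchedDoubleModel_apply, quadHomeomorph, reImHomeomorph, sq]
  ring

/-- **The branched double model is an open map** `ℂ² → ℝ⁴`: it is a homeomorphism, followed by
the product of the identity of `ℝ²` with the squaring map of `ℂ` (open: open mapping theorem,
`Complex.isOpenQuotientMap_pow`), followed by a homeomorphism. [folklore] -/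
theorem isOpenMap_branchedDoubleModel : IsOpenMap branchedDoubleModel := by
  rw [branchedDoubleModel_eq_comp]
  refine quadHomeomorph.isOpenMap.comp (IsOpenMap.comp ?_ reImHomeomorph.isOpenMap)
  exact IsOpenMap.id.prodMap (Complex.isOpenQuotientMap_pow 2).isOpenMap

/-- The image under the model of an open set is open. [folklore] -/
theorem isOpen_image_branchedDoubleModel {s : Set (Fin 2 → ℂ)} (hs : IsOpen s) :
    IsOpen (branchedDoubleModel '' s) :=
  isOpenMap_branchedDoubleModel s hs

/-- The model is continuous. [folklore] -/
theorem continuous_branchedDoubleModel : Continuous branchedDoubleModel :=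
  contDiff_branchedDoubleModel.continuous

/-- The model is surjective (every complex number is a square). [folklore] -/
theorem branchedDoubleModel_surjective : Surjective branchedDoubleModel := by
  rw [branchedDoubleModel_eq_comp]
  refine quadHomeomorph.surjective.comp (Surjective.comp ?_ reImHomeomorph.surjective)
  exact surjective_id.prodMap (Complex.isOpenQuotientMap_pow 2).surjective

/-! ### The derivative and the inverse function theorem off the real locus -/

/-- The coordinate derivatives of the model at `v`: `Re h₀`, `Re h₁`,
`2 (Im v₀ Im h₀ − Im v₁ Im h₁)`, `2 (Im v₁ Im h₀ + Im v₀ Im h₁)`. [folklore] -/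
def branchedDoubleModelDerivCoord (v : Fin 2 → ℂ) : Fin 4 → ((Fin 2 → ℂ) →L[ℝ] ℝ) :=
  ![Complex.reCLM.comp (ContinuousLinearMap.proj 0),
    Complex.reCLM.comp (ContinuousLinearMap.proj 1),
    (2 * (v 0).im) • Complex.imCLM.comp (ContinuousLinearMap.proj 0) -
      (2 * (v 1).im) • Complex.imCLM.comp (ContinuousLinearMap.proj 1),
    (2 * (v 1).im) • Complex.imCLM.comp (ContinuousLinearMap.proj 0) +
      (2 * (v 0).im) • Complex.imCLM.comp (ContinuousLinearMap.proj 1)]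

/-- **The derivative of the model** at `v`, as a continuous linear map `ℂ² →L[ℝ] ℝ⁴`.
[folklore] -/
def branchedDoubleModelDeriv (v : Fin 2 → ℂ) : (Fin 2 → ℂ) →L[ℝ] EuclideanSpace ℝ (Fin 4) :=
  (EuclideanSpace.equiv (Fin 4) ℝ).symm.toContinuousLinearMap.comp
    (ContinuousLinearMap.pi (branchedDoubleModelDerivCoord v))

/-- The coordinates of the derivative (unfolding lemma). [folklore] -/
theorem branchedDoubleModelDeriv_apply (v h : Fin 2 → ℂ) (i : Fin 4) :
    branchedDoubleModelDeriv v h i =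
      ![(h 0).re, (h 1).re, 2 * (v 0).im * (h 0).im - 2 * (v 1).im * (h 1).im,
        2 * (v 1).im * (h 0).im + 2 * (v 0).im * (h 1).im] i := by
  fin_cases i <;>
    simp [branchedDoubleModelDeriv, branchedDoubleModelDerivCoord, mul_assoc]

/-- The `i`-th coordinate of the derivative is the `i`-th coordinate derivative. [folklore] -/
theorem proj_comp_branchedDoubleModelDeriv (v : Fin 2 → ℂ) (i : Fin 4) :
    (PiLp.proj 2 (fun _ : Fin 4 ↦ ℝ) i).comp (branchedDoubleModelDeriv v) =
      branchedDoubleModelDerivCoord v i := by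
  ext h
  fin_cases i <;>
    simp [branchedDoubleModelDeriv, branchedDoubleModelDerivCoord]

/-- **The model is differentiable with derivative `branchedDoubleModelDeriv v`.** [folklore] -/
theorem hasFDerivAt_branchedDoubleModel (v : Fin 2 → ℂ) :
    HasFDerivAt branchedDoubleModel (branchedDoubleModelDeriv v) v := by
  rw [← hasFDerivWithinAt_univ, hasFDerivWithinAt_euclidean]
  intro i
  rw [proj_comp_branchedDoubleModelDeriv, hasFDerivWithinAt_univ]
  have hre : ∀ j : Fin 2, HasFDerivAt (fun v : Fin 2 → ℂ ↦ (v j).re)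
      (Complex.reCLM.comp (ContinuousLinearMap.proj j)) v := fun j ↦
    (Complex.reCLM.comp (ContinuousLinearMap.proj (R := ℝ) (φ := fun _ : Fin 2 ↦ ℂ) j)).hasFDerivAt
  have him : ∀ j : Fin 2, HasFDerivAt (fun v : Fin 2 → ℂ ↦ (v j).im)
      (Complex.imCLM.comp (ContinuousLinearMap.proj j)) v := fun j ↦
    (Complex.imCLM.comp (ContinuousLinearMap.proj (R := ℝ) (φ := fun _ : Fin 2 ↦ ℂ) j)).hasFDerivAt
  fin_cases i
  · simpa [branchedDoubleModel_apply, branchedDoubleModelDerivCoord] using hre 0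
  · simpa [branchedDoubleModel_apply, branchedDoubleModelDerivCoord] using hre 1
  · have h := ((him 0).mul (him 0)).sub ((him 1).mul (him 1))
    refine (h.congr_of_eventuallyEq (Filter.Eventually.of_forall fun w ↦ ?_)).congr_fderiv ?_
    · simp [branchedDoubleModel_apply, sq]
    · ext w
      simp [branchedDoubleModelDerivCoord]
      ring
  · have h := ((him 0).mul (him 1)).const_mul (2 : ℝ)
    refine (h.congr_of_eventuallyEq (Filter.Eventually.of_forall fun w ↦ ?_)).congr_fderiv ?_
    · simp [branchedDoubleModel_apply, mul_assoc]
    · ext w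
      simp [branchedDoubleModelDerivCoord]
      ring

/-- The derivative of the model (as `fderiv`). [folklore] -/
theorem fderiv_branchedDoubleModel (v : Fin 2 → ℂ) :
    fderiv ℝ branchedDoubleModel v = branchedDoubleModelDeriv v :=
  (hasFDerivAt_branchedDoubleModel v).fderiv

/-- **Off the real locus the derivative of the model is injective**: if `(Im v₀, Im v₁) ≠ 0`,
i.e. `v ≠ star v`, then `branchedDoubleModelDeriv v` is injective (its normal block has
determinant `4((Im v₀)² + (Im v₁)²)`). [folklore] -/
theorem branchedDoubleModelDeriv_injective {v : Fin 2 → ℂ} (hv : star v ≠ v) :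
    Injective (branchedDoubleModelDeriv v) := by
  set x := (v 0).im with hx
  set y := (v 1).im with hy
  have hxy : x ^ 2 + y ^ 2 ≠ 0 := by
    intro h0
    have hx0 : x = 0 := by nlinarith [sq_nonneg x, sq_nonneg y]
    have hy0 : y = 0 := by nlinarith [sq_nonneg x, sq_nonneg y]
    apply hv
    funext i
    fin_cases i
    · apply Complex.ext <;> simp [← hx, hx0]
    · apply Complex.ext <;> simp [← hy, hy0]
  refine (injective_iff_map_eq_zero (branchedDoubleModelDeriv v)).2 fun h hh ↦ ?_
  have hc : ∀ i : Fin 4, branchedDoubleModelDeriv v h i = 0 := fun i ↦ by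
    have := congrArg (fun w : EuclideanSpace ℝ (Fin 4) ↦ w i) hh
    simpa using this
  have h0 := hc 0
  have h1 := hc 1
  have h2 := hc 2
  have h3 := hc 3
  simp only [branchedDoubleModelDeriv_apply, Matrix.cons_val_zero, Matrix.cons_val_one,
    Matrix.cons_val] at h0 h1 h2 h3
  -- the normal block: `x a - y b = 0`, `y a + x b = 0` with `a = Im h₀`, `b = Im h₁`
  have ha : (x ^ 2 + y ^ 2) * (h 0).im = 0 := by linear_combination (x * h2 + y * h3) / 2
  have hb : (x ^ 2 + y ^ 2) * (h 1).im = 0 := by linear_combination (x * h3 - y * h2) / 2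
  have ha' : (h 0).im = 0 := (mul_eq_zero.1 ha).resolve_left hxy
  have hb' : (h 1).im = 0 := (mul_eq_zero.1 hb).resolve_left hxy
  funext i
  fin_cases i
  · exact Complex.ext h0 ha'
  · exact Complex.ext h1 hb'

/-- **Off the real locus the derivative of the model is invertible**: a continuous linear
equivalence `ℂ² ≃L[ℝ] ℝ⁴` equal to `branchedDoubleModelDeriv v` (injective linear map between
real `4`-dimensional spaces). [folklore] -/
theorem exists_continuousLinearEquiv_branchedDoubleModelDeriv {v : Fin 2 → ℂ} (hv : star v ≠ v) :
    ∃ L : (Fin 2 → ℂ) ≃L[ℝ] EuclideanSpace ℝ (Fin 4),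
      (L : (Fin 2 → ℂ) →L[ℝ] EuclideanSpace ℝ (Fin 4)) = branchedDoubleModelDeriv v := by
  have hdim : Module.finrank ℝ (Fin 2 → ℂ) = Module.finrank ℝ (EuclideanSpace ℝ (Fin 4)) := by
    simp [Module.finrank_pi_fintype, Complex.finrank_real_complex]
  set L₀ := LinearMap.linearEquivOfInjective
    (branchedDoubleModelDeriv v : (Fin 2 → ℂ) →ₗ[ℝ] EuclideanSpace ℝ (Fin 4))
    (branchedDoubleModelDeriv_injective hv) hdim with hL₀
  refine ⟨L₀.toContinuousLinearEquiv, ?_⟩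
  ext h i
  rfl

/-- **The branched double model is a `C^∞` local diffeomorphism at every non-real point**
(inverse function theorem; the branch locus of `X → X/conj` is exactly the real part `Fix conj`).
[folklore] -/
theorem isLocalDiffeomorphAt_branchedDoubleModel {v : Fin 2 → ℂ} (hv : star v ≠ v) :
    IsLocalDiffeomorphAt 𝓘(ℝ, Fin 2 → ℂ) (𝓡 4) ∞ branchedDoubleModel v := by
  obtain ⟨L, hL⟩ := exists_continuousLinearEquiv_branchedDoubleModelDeriv hv
  exact isLocalDiffeomorphAt_of_hasFDerivAt_equiv' contDiff_branchedDoubleModel (by simp) L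
    (hL ▸ hasFDerivAt_branchedDoubleModel v)

/-- The non-real points form an open set of `ℂ²`. [folklore] -/
theorem isOpen_setOf_star_ne : IsOpen {v : Fin 2 → ℂ | star v ≠ v} :=
  isOpen_ne_fun continuous_star continuous_id

/-- **A smooth local inverse of the model at a non-real point**: there is an open partial
homeomorphism `β : ℂ² ⇀ ℝ⁴` agreeing with the model on its source, with `v ∈ β.source`, `C^∞`
with `C^∞` inverse (the `PartialDiffeomorph` of `isLocalDiffeomorphAt_branchedDoubleModel`,
unbundled). [folklore] -/
theorem exists_localInverse_branchedDoubleModel {v : Fin 2 → ℂ} (hv : star v ≠ v) :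
    ∃ β : OpenPartialHomeomorph (Fin 2 → ℂ) (EuclideanSpace ℝ (Fin 4)), v ∈ β.source ∧
      (∀ w ∈ β.source, β w = branchedDoubleModel w) ∧
      ContDiffOn ℝ ∞ β β.source ∧ ContDiffOn ℝ ∞ β.symm β.target := by
  obtain ⟨e, hve, heq⟩ := isLocalDiffeomorphAt_branchedDoubleModel hv
  refine ⟨e.toOpenPartialHomeomorph, hve, fun w hw ↦ (heq hw).symm, ?_, ?_⟩
  · exact contMDiffOn_iff_contDiffOn.1 e.contMDiffOn_toFun
  · exact contMDiffOn_iff_contDiffOn.1 e.contMDiffOn_invFun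

end Literature.Topology.FourManifolds

end
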